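import Literature.AlgebraicGeometry.Limits.SubalgebraDiagram
import Literature.AlgebraicGeometry.Morphisms.FormalFunctions
import HarnessLib

/-!
# Universal Stein property: from the Noetherian levels to every base change

Topic `Literature/AlgebraicGeometry/Morphisms`; theorems only (no definition, no named fact, no
instance). Let `p : Y → S` be quasi-compact and quasi-separated over a locally Noetherian `S`, and
suppose that for every NOETHERIAN ring `R` and every `i : Spec R → S` the base change
`Y ×_S Spec R → Spec R` is Stein (`R ⥲ Γ(Y ×_S Spec R, 𝒪)`, the tree's `Morphisms.algebraMapΓ`
bijective). Then the same holds for EVERY ring `C` and every `i : Spec C → S`, and hence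
`Γ(W, 𝒪_T) ⥲ Γ(π⁻¹W, 𝒪)` for every scheme `T`, every `g : T → S`, every open `W ⊆ T` and the base
change `π : Y ×_S T → T` — no finiteness hypothesis on `T`.

Proof: absolute Noetherian approximation of the base in the form the tree holds
(`Limits/SubalgebraDiagram`, [GortzWedhorn2020] (10.13)): over an affine open `U = Spec K` of `S`
(`K` Noetherian) write `C = ⋃_t K[t]` (finitely generated `K`-subalgebras), so that
`Y_U ×_K Spec C = lim_t (Y_U ×_K Spec K[t])` (`SubalgApprox.isLimitProdCone`) is a cofiltered limit
of quasi-compact quasi-separated schemes with affine transition maps; by [StacksProject, Tag 01YT]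
(Mathlib `exists_appTop_π_eq_of_isLimit`, `exists_appTop_map_eq_zero_of_isLimit`) a global
function on the limit comes from a stage — where, `K[t]` being Noetherian, it is a scalar — and a
scalar `b ∈ K[t]` dying on the limit dies on some later stage, hence `b = 0`. The passage to all
opens of an arbitrary `T` is the sheaf property over the basis of affine opens `V ⊆ T` with `g(V)`
inside an affine open of `S`.

* `bijective_algebraMapΓ_tensor_of_finiteTypeLevels` — the limit argument over `Spec K`;
* `bijective_algebraMapΓ_snd_of_noetherianLevels_of_fromSpec` — affine test schemes over an
  affine Noetherian open `U ⊆ S`;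
* `app_bijective_snd_of_noetherianLevels` — **every open of every `T`**;
* `bijective_algebraMapΓ_snd_of_noetherianLevels` — every affine test scheme `Spec C → S`.

Consumer (cell `hodgecm-mathlib`, Hecke-link socket (B), D6 (u7-iv)): the universal Stein
property `hStein` of an abelian scheme over a locally Noetherian base for ALL test schemes `T`,
from its Noetherian levels (`Morphisms/SteinOfArtinLevels`). HC_CM is proved only modulo the 7
printed citations until rung 0 closes.

## References
* [StacksProject] The Stacks Project, Tag 01YT (Limits of schemes): Lemma 01Z0, Tag 01Z4.
* [GortzWedhorn2020] U. Görtz, T. Wedhorn, *Algebraic Geometry I*, 2nd ed., (10.13) p. 321,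
  Thm. 10.57.
* [GortzWedhorn2023] U. Görtz, T. Wedhorn, *Algebraic Geometry II*, Cor. 24.63 (cohomological
  flatness in dimension `0`, the statement made universal here).
-/

noncomputable section

open CategoryTheory CategoryTheory.Limits AlgebraicGeometry TopologicalSpace Opposite
open MonoidalCategory

universe u

namespace Literature.AlgebraicGeometry.Morphisms

open Literature.AlgebraicGeometry.Motives (SchemeOver specOver)
open Literature.AlgebraicGeometry.Limits

/-! ## §0 Plumbing: scalars under pull-back -/

section Plumbing

/-- Along a commutative triangle `z ≫ g = h` over `Spec B`, pulling back global functions sends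
`algebraMapΓ g b` to `algebraMapΓ h b`. [folklore] -/
private theorem appTop_algebraMapΓ_triangle {B : Type u} [CommRing B] {Y Z : Scheme.{u}}
    (g : Y ⟶ Spec (.of B)) (h : Z ⟶ Spec (.of B)) (z : Z ⟶ Y) (w : z ≫ g = h) (b : B) :
    z.appTop.hom (algebraMapΓ g b) = algebraMapΓ h b := by
  subst w
  change (g.appTop ≫ z.appTop).hom ((Scheme.ΓSpecIso (.of B)).inv.hom b) = _
  rw [← Scheme.Hom.comp_appTop]
  rfl

/-- Along a commutative square `z ≫ g = h ≫ Spec φ`, pulling back global functions sends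
`algebraMapΓ g b` to `algebraMapΓ h (φ b)`. [folklore] -/
private theorem appTop_algebraMapΓ_square {B B' : Type u} [CommRing B] [CommRing B']
    (φ : B →+* B') {Y Z : Scheme.{u}}
    (g : Y ⟶ Spec (.of B)) (h : Z ⟶ Spec (.of B')) (z : Z ⟶ Y)
    (w : z ≫ g = h ≫ Spec.map (CommRingCat.ofHom φ)) (b : B) :
    z.appTop.hom (algebraMapΓ g b) = algebraMapΓ h (φ b) := by
  rw [appTop_algebraMapΓ_triangle g (h ≫ Spec.map (CommRingCat.ofHom φ)) z w b]
  change ((h ≫ Spec.map (CommRingCat.ofHom φ)).appTop.hom.comp (Scheme.ΓSpecIso (.of B)).inv.hom) b =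
    (h.appTop.hom.comp (Scheme.ΓSpecIso (.of B')).inv.hom) (φ b)
  have hnat := Scheme.ΓSpecIso_inv_naturality (CommRingCat.ofHom φ)
  rw [Scheme.Hom.comp_appTop]
  change h.appTop.hom (((Scheme.ΓSpecIso (.of B)).inv ≫
      (Spec.map (CommRingCat.ofHom φ)).appTop).hom b) =
    h.appTop.hom ((Scheme.ΓSpecIso (.of B')).inv.hom (φ b))
  rw [← hnat]
  rfl

end Plumbing

/-! ## §1 The limit argument over an affine base `Spec K` -/

section Core

variable {K : Type u} [CommRing K] (P : SchemeOver K) [QuasiCompact P.hom] [QuasiSeparated P.hom]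

/-- **The limit argument.** Let `P → Spec K` be quasi-compact and quasi-separated and suppose
that for every finitely generated `K`-algebra `R` the structure map `R → Γ(P ×_K Spec R, 𝒪)` is
bijective. Then `C → Γ(P ×_K Spec C, 𝒪)` is bijective for EVERY `K`-algebra `C`:
`P ×_K Spec C = lim_t P ×_K Spec K[t]` over the finitely generated subalgebras `K[t] ⊆ C`
(`SubalgApprox.isLimitProdCone`), global functions on the limit come from a stage, and a
function on a stage dying on the limit dies on a later stage. [cite: StacksProject, Tag 01YT
(Lemma 01Z0)] [cite: GortzWedhorn2020, (10.13) and Thm. 10.57] -/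
theorem bijective_algebraMapΓ_tensor_of_finiteTypeLevels
    (hN : ∀ (R : Type u) [CommRing R] [Algebra K R] [Algebra.FiniteType K R],
      Function.Bijective
        (algebraMapΓ (pullback.snd P.hom (Spec.map (CommRingCat.ofHom (algebraMap K R))))))
    (C : Type u) [CommRing C] [Algebra K C] :
    Function.Bijective
      (algebraMapΓ (pullback.snd P.hom (Spec.map (CommRingCat.ofHom (algebraMap K C))))) := by
  classical
  -- the limit presentation `(P ⊗ Spec C).left = lim_t (P ⊗ Spec K[t]).left`
  let D := SubalgApprox.prodDiagram K C ∅ P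
  let c := SubalgApprox.prodCone K C ∅ P
  have hc : IsLimit c := SubalgApprox.isLimitProdCone K C ∅ P
  -- structure maps of the stages and of the limit
  let str : (P ⊗ specOver K C).left ⟶ Spec (.of C) := pullback.snd P.hom (specOver K C).hom
  let strT : ∀ t : (SubalgApprox.Idx C (∅ : Finset C))ᵒᵖ,
      D.obj t ⟶ Spec (.of ↥(SubalgApprox.sub K C t.unop.1)) := fun t =>
    pullback.snd P.hom (specOver K ↥(SubalgApprox.sub K C t.unop.1)).hom
  have hleg : ∀ t, c.π.app t ≫ strT t =
      str ≫ Spec.map (CommRingCat.ofHom (SubalgApprox.sub K C t.unop.1).val.toRingHom) := fun t =>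
    SubalgApprox.prodCone_π_app_snd K C ∅ P t
  have htr : ∀ {t t' : (SubalgApprox.Idx C (∅ : Finset C))ᵒᵖ} (f : t ⟶ t'),
      D.map f ≫ strT t' = strT t ≫ Spec.map (CommRingCat.ofHom
        (Subalgebra.inclusion (SubalgApprox.sub_mono (K := K) f.unop.le)).toRingHom) :=
    fun f => SubalgApprox.prodDiagram_map_snd K C ∅ P f
  -- Stein at every stage (the stages are of finite type over `K`)
  have hNt : ∀ t, Function.Bijective (algebraMapΓ (strT t)) := fun t => hN _
  change Function.Bijective (algebraMapΓ str)
  refine ⟨(injective_iff_map_eq_zero _).mpr fun b hb => ?_, fun s => ?_⟩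
  · -- injectivity: `b ∈ K[t]`; the scalar `b` on stage `t` dies on the limit, hence on a later stage
    obtain ⟨t, hbt⟩ := SubalgApprox.exists_mem_sub K C ∅ b
    let r : ↥(SubalgApprox.sub K C t.1) := ⟨b, hbt⟩
    have e1 : (c.π.app (op t)).appTop.hom (algebraMapΓ (strT (op t)) r) = algebraMapΓ str b :=
      appTop_algebraMapΓ_square (SubalgApprox.sub K C t.1).val.toRingHom (strT (op t)) str
        (c.π.app (op t)) (hleg (op t)) r
    obtain ⟨t', f, hf⟩ := exists_appTop_map_eq_zero_of_isLimit D c hc (i := op t)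
      (algebraMapΓ (strT (op t)) r) (e1.trans hb)
    have e2 := appTop_algebraMapΓ_square
      (Subalgebra.inclusion (SubalgApprox.sub_mono (K := K) f.unop.le)).toRingHom
      (strT (op t)) (strT t') (D.map f) (htr f) r
    exact congrArg Subtype.val
      ((injective_iff_map_eq_zero _).mp (hNt t').1 _ (e2.symm.trans hf))
  · -- surjectivity: a global function on the limit comes from a stage, where it is a scalar
    obtain ⟨t, x, hx⟩ := exists_appTop_π_eq_of_isLimit D c hc s
    obtain ⟨r, hr⟩ := (hNt t).2 x
    have e6 := appTop_algebraMapΓ_square (SubalgApprox.sub K C t.unop.1).val.toRingHom (strT t)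
      str (c.π.app t) (hleg t) r
    rw [hr] at e6
    exact ⟨(SubalgApprox.sub K C t.unop.1).val r, e6.symm.trans hx.symm⟩

end Core

/-! ## §2 Plumbing: isomorphisms over the base, pasting, restriction to affine opens -/

section Plumbing2

/-- Stein is invariant under an isomorphism over the base. [folklore] -/
private theorem bijective_algebraMapΓ_iso_over {B : Type u} [CommRing B] {P Q : Scheme.{u}}
    (hP : P ⟶ Spec (.of B)) (hQ : Q ⟶ Spec (.of B)) (k : P ≅ Q) (w : k.hom ≫ hQ = hP)
    (h : Function.Bijective (algebraMapΓ hQ)) : Function.Bijective (algebraMapΓ hP) := by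
  have e : (algebraMapΓ hP : B → Γ(P, ⊤)) = k.hom.appTop.hom ∘ algebraMapΓ hQ := by
    funext b
    exact (appTop_algebraMapΓ_triangle hQ hP k.hom w b).symm
  rw [e]
  haveI : IsIso k.hom.appTop := by
    change IsIso (k.hom.app ⊤)
    infer_instance
  exact (ConcreteCategory.bijective_of_isIso k.hom.appTop).comp h

/-- Stein for the base change along `b' ≫ b` from / to Stein for the iterated base change
(pasting `pullback (pullback.snd p b) b' ≅ pullback p (b' ≫ b)` over `Spec C`). [folklore] -/
private theorem bijective_algebraMapΓ_snd_snd_iff {S Y T' : Scheme.{u}} (p : Y ⟶ S) {C : Type u}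
    [CommRing C] (b : T' ⟶ S) (b' : Spec (.of C) ⟶ T') :
    Function.Bijective (algebraMapΓ (pullback.snd (pullback.snd p b) b')) ↔
      Function.Bijective (algebraMapΓ (pullback.snd p (b' ≫ b))) :=
  ⟨bijective_algebraMapΓ_iso_over _ _ (pullbackLeftPullbackSndIso p b b').symm
      (by rw [Iso.symm_hom, Iso.inv_comp_eq, pullbackLeftPullbackSndIso_hom_snd]),
    bijective_algebraMapΓ_iso_over _ _ (pullbackLeftPullbackSndIso p b b')
      (pullbackLeftPullbackSndIso_hom_snd p b b')⟩

/-- `algebraMapΓ h` is bijective iff `h.appTop` is. [folklore] -/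
private theorem bijective_algebraMapΓ_iff_appTop {B : Type u} [CommRing B] {Z : Scheme.{u}}
    (h : Z ⟶ Spec (.of B)) :
    Function.Bijective (algebraMapΓ h) ↔ Function.Bijective h.appTop := by
  change Function.Bijective (h.appTop.hom ∘ (Scheme.ΓSpecIso (.of B)).inv.hom) ↔ _
  exact Function.Bijective.of_comp_iff _
    (ConcreteCategory.bijective_of_isIso (Scheme.ΓSpecIso (.of B)).inv)

/-- `Γ(V, 𝒪_T) → Γ(π⁻¹V, 𝒪_X)` is bijective as soon as `(π|_V)^♯` is bijective on global sections.
[folklore] -/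
private theorem app_bijective_of_appTop_morphismRestrict {X T : Scheme.{u}} (π : X ⟶ T)
    (V : T.Opens) (h : Function.Bijective (π ∣_ V).appTop) : Function.Bijective (π.app V) := by
  have e := morphismRestrict_appTop π V
  rw [e] at h
  have h' : Function.Bijective
      ((X.presheaf.map (eqToHom (image_morphismRestrict_preimage π V ⊤)).op).hom ∘
        (π.app (V.ι ''ᵁ ⊤)).hom) := h
  have key : ∀ V' : T.Opens, V' = V → Function.Bijective (π.app V') →
      Function.Bijective (π.app V) := by
    rintro V' rfl h'; exact h'
  exact key _ (V.ι_image_top) ((Function.Bijective.of_comp_iff' (ConcreteCategory.bijective_of_isIso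
    (X.presheaf.map (eqToHom (image_morphismRestrict_preimage π V ⊤)).op)) _).mp h')

/-- `(π|_V)^♯` is bijective on global sections as soon as the base change of `π` along
`Spec Γ(V, 𝒪_T) → T` is Stein (`π⁻¹V ≅ X ×_T Spec Γ(V)` over `Spec Γ(V) ≅ V`). [folklore] -/
private theorem appTop_morphismRestrict_bijective_of_snd {X T : Scheme.{u}} (π : X ⟶ T)
    (V : T.Opens) (hV : IsAffineOpen V)
    (h : Function.Bijective (algebraMapΓ (pullback.snd π hV.fromSpec))) :
    Function.Bijective (π ∣_ V).appTop := by
  have s1 := isPullback_morphismRestrict π V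
  have s2 : IsPullback hV.isoSpec.hom V.ι hV.fromSpec (𝟙 T) :=
    IsPullback.of_horiz_isIso ⟨by rw [Category.comp_id, ← IsAffineOpen.isoSpec_inv_ι,
      Iso.hom_inv_id_assoc]⟩
  have sq : IsPullback (π ∣_ V ≫ hV.isoSpec.hom) ((π ⁻¹ᵁ V).ι) hV.fromSpec π := by
    have h12 := s1.paste_horiz s2
    rwa [Category.comp_id] at h12
  have hk : sq.flip.isoPullback.hom ≫ pullback.snd π hV.fromSpec = π ∣_ V ≫ hV.isoSpec.hom :=
    sq.flip.isoPullback_hom_snd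
  have h3 : Function.Bijective (algebraMapΓ (π ∣_ V ≫ hV.isoSpec.hom)) :=
    bijective_algebraMapΓ_iso_over _ _ sq.flip.isoPullback hk h
  have e3 : (algebraMapΓ (π ∣_ V ≫ hV.isoSpec.hom) : Γ(T, V) → _) =
      (π ∣_ V).appTop.hom ∘ (hV.isoSpec.hom.appTop.hom ∘ (Scheme.ΓSpecIso Γ(T, V)).inv.hom) := by
    funext r
    change ((π ∣_ V ≫ hV.isoSpec.hom).appTop.hom.comp (Scheme.ΓSpecIso Γ(T, V)).inv.hom) r = _
    rw [Scheme.Hom.comp_appTop]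
    rfl
  rw [e3] at h3
  haveI : IsIso hV.isoSpec.hom.appTop := by
    change IsIso (hV.isoSpec.hom.app ⊤); infer_instance
  exact (Function.Bijective.of_comp_iff _
    ((ConcreteCategory.bijective_of_isIso hV.isoSpec.hom.appTop).comp
      (ConcreteCategory.bijective_of_isIso (Scheme.ΓSpecIso Γ(T, V)).inv))).mp h3

end Plumbing2

/-! ## §3 Gluing: bijectivity on a basis of affine opens gives bijectivity on every open -/

section Sheaf

variable {X T : Scheme.{u}} (π : X ⟶ T) (Q : T.affineOpens → Prop)
  (hQ : ∀ (W : T.Opens) (x : T), x ∈ W → ∃ V : T.affineOpens, Q V ∧ x ∈ (V : T.Opens) ∧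
    (V : T.Opens) ≤ W)

include hQ in
/-- If `Γ(V, 𝒪_T) → Γ(π⁻¹V, 𝒪_X)` is bijective for all affine opens `V` of a basis `Q`, it is
bijective for every open `W`: injectivity by locality of `𝒪_T`; surjectivity by gluing local
preimages in `𝒪_T`, compatible on the intersections `V ∩ V'` by injectivity there, and locality
in `𝒪_X`. [folklore] -/
private theorem app_bijective_of_basis
    (hV : ∀ V : T.affineOpens, Q V → Function.Bijective (π.app V)) (W : T.Opens) :
    Function.Bijective (π.app W) := by
  have hnat : ∀ {A B : T.Opens} (e : B ≤ A) (x : Γ(T, A)),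
      π.app B (T.presheaf.map (homOfLE e).op x) =
        X.presheaf.map (homOfLE (π.preimage_mono e)).op (π.app A x) :=
    fun e x => ConcreteCategory.congr_hom (π.naturality (homOfLE e).op) x
  -- the `Q`-affine opens inside an open `W` cover `W`
  let J (W : T.Opens) := {V : T.affineOpens // Q V ∧ (V : T.Opens) ≤ W}
  have hcover : ∀ W : T.Opens, W ≤ ⨆ V : J W, ((V.1 : T.affineOpens) : T.Opens) := by
    intro W x hx
    obtain ⟨V, hVQ, hxV, hVW⟩ := hQ W x hx
    exact Opens.mem_iSup.mpr ⟨⟨V, hVQ, hVW⟩, hxV⟩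
  have hinj : ∀ W : T.Opens, Function.Injective (π.app W) := by
    intro W s s' hss'
    apply T.sheaf.eq_of_locally_eq' (fun V : J W => ((V.1 : T.affineOpens) : T.Opens)) W
      (fun V => homOfLE V.2.2) (hcover W)
    intro V
    apply (hV V.1 V.2.1).1
    change π.app _ (T.presheaf.map (homOfLE V.2.2).op s) =
      π.app _ (T.presheaf.map (homOfLE V.2.2).op s')
    rw [hnat, hnat, hss']
  refine ⟨hinj W, fun t => ?_⟩
  let U : J W → T.Opens := fun V => ((V.1 : T.affineOpens) : T.Opens)
  -- local preimages, compatible by injectivity on the intersections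
  choose s hs using fun V : J W => (hV V.1 V.2.1).2
    (X.presheaf.map (homOfLE (π.preimage_mono V.2.2)).op t)
  have hcompat : TopCat.Presheaf.IsCompatible T.sheaf.1 U s := by
    intro V V'
    apply hinj (U V ⊓ U V')
    change π.app _ (T.presheaf.map (homOfLE inf_le_left).op (s V)) =
      π.app _ (T.presheaf.map (homOfLE inf_le_right).op (s V'))
    rw [hnat inf_le_left (s V), hnat inf_le_right (s V'), hs V, hs V']
    change (X.presheaf.map _ ≫ X.presheaf.map _) t = (X.presheaf.map _ ≫ X.presheaf.map _) t
    rw [← Functor.map_comp, ← Functor.map_comp]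
    rfl
  obtain ⟨sW, hsW, -⟩ :=
    T.sheaf.existsUnique_gluing' U W (fun V => homOfLE V.2.2) (hcover W) s hcompat
  refine ⟨sW, ?_⟩
  -- `π^♯ sW = t` locally on the cover `π⁻¹ U_V` of `π⁻¹ W`
  apply X.sheaf.eq_of_locally_eq' (fun V : J W => π ⁻¹ᵁ (U V)) (π ⁻¹ᵁ W)
    (fun V => homOfLE (π.preimage_mono V.2.2))
    (by rw [← Scheme.Hom.preimage_iSup]; exact π.preimage_mono (hcover W))
  intro V
  change X.presheaf.map (homOfLE (π.preimage_mono V.2.2)).op (π.app W sW) = _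
  rw [← hnat V.2.2 sW]
  change π.app _ (T.sheaf.1.map (homOfLE V.2.2).op sW) = _
  rw [hsW V, hs V]
  rfl

end Sheaf

/-! ## §4 From the Noetherian levels to every base change -/

section Main

variable {Y S : Scheme.{u}} (p : Y ⟶ S) [QuasiCompact p] [QuasiSeparated p]
  (hN : ∀ (R : Type u) [CommRing R] [IsNoetherianRing R] (i : Spec (.of R) ⟶ S),
    Function.Bijective (algebraMapΓ (pullback.snd p i)))

include hN in
/-- **Affine pieces over an affine Noetherian open of the base.** For an affine open `U ⊆ S` with
`K = Γ(U, 𝒪_S)` Noetherian and ANY ring `C` with `j : Spec C → Spec K`, the base change of `p`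
along `Spec C → U ⊆ S` is Stein (`Y_U ×_U Spec C = lim_t Y_U ×_U Spec K[t]` with Noetherian stages).
[cite: StacksProject, Tag 01YT (Lemma 01Z0)] [cite: GortzWedhorn2020, (10.13) and Thm. 10.57] -/
theorem bijective_algebraMapΓ_snd_of_noetherianLevels_of_fromSpec (U : S.Opens)
    (hU : IsAffineOpen U) [IsNoetherianRing Γ(S, U)] {C : Type u} [CommRing C]
    (j : Spec (.of C) ⟶ Spec Γ(S, U)) :
    Function.Bijective (algebraMapΓ (pullback.snd p (j ≫ hU.fromSpec))) := by
  obtain ⟨φ, rfl⟩ : ∃ φ : Γ(S, U) ⟶ CommRingCat.of C, j = Spec.map φ :=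
    ⟨Spec.preimage j, (Spec.map_preimage j).symm⟩
  letI : Algebra Γ(S, U) C := φ.hom.toAlgebra
  -- the quasi-compact quasi-separated `Γ(U)`-scheme `Y ×_S U → Spec Γ(U)`
  let P : SchemeOver ↑Γ(S, U) := Over.mk (pullback.snd p hU.fromSpec)
  haveI : QuasiCompact P.hom := inferInstanceAs (QuasiCompact (pullback.snd p hU.fromSpec))
  haveI : QuasiSeparated P.hom := inferInstanceAs (QuasiSeparated (pullback.snd p hU.fromSpec))
  have hft : ∀ (R : Type u) [CommRing R] [Algebra ↑Γ(S, U) R] [Algebra.FiniteType ↑Γ(S, U) R],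
      Function.Bijective (algebraMapΓ (pullback.snd P.hom
        (Spec.map (CommRingCat.ofHom (algebraMap ↑Γ(S, U) R))))) := by
    intro R _ _ _
    haveI : IsNoetherianRing R := Algebra.FiniteType.isNoetherianRing ↑Γ(S, U) R
    exact (bijective_algebraMapΓ_snd_snd_iff p hU.fromSpec _).mpr (hN R _)
  have hC := bijective_algebraMapΓ_tensor_of_finiteTypeLevels P hft C
  have e : CommRingCat.ofHom (algebraMap ↑Γ(S, U) C) = φ := CommRingCat.ofHom_hom φ
  rw [e] at hC
  exact (bijective_algebraMapΓ_snd_snd_iff p hU.fromSpec (Spec.map φ)).mp hC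

include hN in
/-- **Universal Stein property from the Noetherian levels.** Let `p : Y → S` be quasi-compact
and quasi-separated over a locally Noetherian `S`, and assume that for every Noetherian ring `R`
and every `i : Spec R → S` the structure map `R → Γ(Y ×_S Spec R, 𝒪)` is bijective. Then for
EVERY scheme `T` (no finiteness assumption), every `g : T → S` and every open `W ⊆ T`, the
comorphism `Γ(W, 𝒪_T) → Γ(π⁻¹W, 𝒪)` of the base change `π : Y ×_S T → T` is bijective
(absolute Noetherian approximation of the base: global sections of a cofiltered limit of
quasi-compact quasi-separated schemes with affine transition maps are the colimit of the global
sections of the stages). [cite: StacksProject, Tag 01YT (Lemma 01Z0)] [cite: GortzWedhorn2020,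
(10.13) and Thm. 10.57] -/
theorem app_bijective_snd_of_noetherianLevels [IsLocallyNoetherian S] {T : Scheme.{u}}
    (g : T ⟶ S) (W : T.Opens) : Function.Bijective ((pullback.snd p g).app W) := by
  -- the basis: affine opens of `T` mapping into an affine open of `S`
  let Q : T.affineOpens → Prop := fun V => ∃ U : S.affineOpens, (V : T.Opens) ≤ g ⁻¹ᵁ (U : S.Opens)
  have hQ : ∀ (W : T.Opens) (x : T), x ∈ W → ∃ V : T.affineOpens, Q V ∧ x ∈ (V : T.Opens) ∧
      (V : T.Opens) ≤ W := by
    intro W x hx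
    obtain ⟨_, ⟨U, hU, rfl⟩, hxU, -⟩ :=
      S.isBasis_affineOpens.exists_subset_of_mem_open (Set.mem_univ (g.base x)) isOpen_univ
    obtain ⟨_, ⟨V, hV, rfl⟩, hxV, hVW⟩ :=
      T.isBasis_affineOpens.exists_subset_of_mem_open (a := x) (show x ∈ W ⊓ g ⁻¹ᵁ U from
        ⟨hx, hxU⟩) (W ⊓ g ⁻¹ᵁ U).2
    exact ⟨⟨V, hV⟩, ⟨⟨U, hU⟩, fun y hy => (hVW hy).2⟩, hxV, fun y hy => (hVW hy).1⟩
  apply app_bijective_of_basis (pullback.snd p g) Q hQ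
  rintro V ⟨U, hVU⟩
  haveI : IsNoetherianRing Γ(S, (U : S.Opens)) := IsLocallyNoetherian.component_noetherian U
  -- `Spec Γ(V) → T → S` factors through `Spec Γ(U) → S`
  have hrange : Set.range (V.2.fromSpec ≫ g).base ⊆ Set.range (U : S.Opens).ι.base := by
    rintro _ ⟨z, rfl⟩
    rw [Scheme.Opens.range_ι]
    exact hVU (V.2.range_fromSpec.le ⟨z, rfl⟩)
  let j : Spec Γ(T, (V : T.Opens)) ⟶ Spec Γ(S, (U : S.Opens)) :=
    IsOpenImmersion.lift (U : S.Opens).ι (V.2.fromSpec ≫ g) hrange ≫ U.2.isoSpec.hom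
  have hj : j ≫ U.2.fromSpec = V.2.fromSpec ≫ g := by
    change (IsOpenImmersion.lift _ _ hrange ≫ U.2.isoSpec.hom) ≫ U.2.fromSpec = _
    rw [Category.assoc, ← U.2.isoSpec_inv_ι, Iso.hom_inv_id_assoc]
    exact IsOpenImmersion.lift_fac _ _ hrange
  have h1 : Function.Bijective (algebraMapΓ (pullback.snd p (V.2.fromSpec ≫ g))) := by
    rw [← hj]
    exact bijective_algebraMapΓ_snd_of_noetherianLevels_of_fromSpec p hN U U.2 j
  exact app_bijective_of_appTop_morphismRestrict _ _ (appTop_morphismRestrict_bijective_of_snd _ _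
    V.2 ((bijective_algebraMapΓ_snd_snd_iff p g V.2.fromSpec).mpr h1))

include hN in
/-- **Corollary (affine test schemes).** Under the same hypotheses, for EVERY ring `C` and every
`i : Spec C → S` the structure map `C → Γ(Y ×_S Spec C, 𝒪)` is bijective.
[cite: StacksProject, Tag 01YT (Lemma 01Z0)] [cite: GortzWedhorn2020, (10.13) and Thm. 10.57] -/
theorem bijective_algebraMapΓ_snd_of_noetherianLevels [IsLocallyNoetherian S] {C : Type u}
    [CommRing C] (i : Spec (.of C) ⟶ S) :
    Function.Bijective (algebraMapΓ (pullback.snd p i)) := by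
  rw [bijective_algebraMapΓ_iff_appTop]
  exact app_bijective_snd_of_noetherianLevels p hN i ⊤

end Main

end Literature.AlgebraicGeometry.Morphisms
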